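import Literature.ModelTheory.ExponentialFields.CylindricalDecompositionProofs
import Literature.ModelTheory.ExponentialFields.SemialgebraicDimension
import Literature.NumberTheory.Transcendental.KZGroundingRelations

/-!
# `SectorToKernel` (stmt-KontsevichZagierPeriods-10813), line `effective-cube-surjection`:
# stub D — cell facts for cylindrical decompositions

Three elementary facts about the cells of a cylindrical decomposition
[Basu–Pollack–Roy 2006, Def. 5.1] used by the lead's induction (`stub_nashCellReductionOf`):

1. every cell of a `ℚ`-cylindrical decomposition of `ℝⁿ` is open or has empty interior (a cell of
   the decomposition is an `(i₁, …, iₙ)`-cell, `IsCylindricalDecomposition.exists_isSACell`; a cell of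
   full dimension is open, `IsSACell.isOpen`, one of smaller dimension has empty interior,
   `IsSACell.interior_eq_empty` — graphs are thin, bands over open bases with continuous walls are
   open, bands over thin bases are thin because `Fin.init` is an open map);
2. a bounded band over a nonempty base, cut out by sections strictly increasing over the base, is an
   inner band (`j ≠ 0`, `j ≠ ℓ`: an extreme band contains a vertical half-line) over a bounded base
   (every point of the base carries a point of the band, `CylindricalDecomposition.exists_mem_band`,
   and `‖x‖ ≤ ‖(x, t)‖`);
3. the band `{(x, t) | x ∈ S, a x < t < b x}` over an open `S` with walls continuous on `S` is open.

The monotonicity hypothesis in (2) is necessary: without it an inner band may be empty (walls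
crossed), hence bounded, over an unbounded base.
-/

noncomputable section

namespace Summit.KontsevichZagierPeriods.FurushoPentagon.SectorToKernel

open Set Filter Topology
open Literature.ModelTheory.ExponentialFields
open Literature.NumberTheory.Transcendental

/-- **Cells are open or thin.** Every cell of a `ℚ`-cylindrical decomposition of `ℝⁿ` is open or
has empty interior: it is an `(i₁, …, iₙ)`-cell of some dimension `d ≤ n`, open if `d = n` and with
empty interior if `d < n`. [cite: BasuPollackRoy2006, Def. 5.1 and Prop. 5.3] -/
theorem isOpen_or_interior_eq_empty_of_isCylindricalDecomposition (n : ℕ)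
    (𝒮 : Finset (Set (Fin n → ℝ))) (h : IsCylindricalDecomposition ℚ n 𝒮) :
    ∀ S ∈ 𝒮, IsOpen S ∨ interior S = ∅ := by
  intro S hS
  obtain ⟨d, hcell⟩ := h.exists_isSACell S hS
  rcases hcell.le.eq_or_lt with hd | hd
  · exact Or.inl (hcell.isOpen hd)
  · exact Or.inr (hcell.interior_eq_empty hd)

/-- A point `(y, t)` of a set contained in the closed ball of radius `R` about `0` has `‖y‖ ≤ R`
and `|t| ≤ R` (sup norm). [folklore] -/
theorem norm_le_and_abs_le_of_snoc_mem {n : ℕ} {T : Set (Fin (n + 1) → ℝ)} {R : ℝ}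
    (hR : T ⊆ Metric.closedBall 0 R) {y : Fin n → ℝ} {t : ℝ}
    (h : (Fin.snoc y t : Fin (n + 1) → ℝ) ∈ T) : ‖y‖ ≤ R ∧ |t| ≤ R := by
  have h1 := hR h
  rw [Metric.mem_closedBall, dist_zero_right] at h1
  refine ⟨(pi_norm_le_iff_of_nonneg ((norm_nonneg _).trans h1)).2 fun i => ?_, ?_⟩
  · calc ‖y i‖ = ‖(Fin.snoc y t : Fin (n + 1) → ℝ) (Fin.castSucc i)‖ := by rw [Fin.snoc_castSucc]
      _ ≤ ‖(Fin.snoc y t : Fin (n + 1) → ℝ)‖ := norm_le_pi_norm _ _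
      _ ≤ R := h1
  · calc |t| = ‖(Fin.snoc y t : Fin (n + 1) → ℝ) (Fin.last n)‖ := by
          rw [Fin.snoc_last, Real.norm_eq_abs]
      _ ≤ ‖(Fin.snoc y t : Fin (n + 1) → ℝ)‖ := norm_le_pi_norm _ _
      _ ≤ R := h1

/-- **A bounded band over a nonempty base is not the lowest band**: the lowest band contains, above
any point of the base, a vertical half-line `(-∞, c)`. [cite: BasuPollackRoy2006, Def. 5.1] -/
theorem ne_zero_of_isBounded_bandOver {n l : ℕ} {S : Set (Fin n → ℝ)}
    (ξ : Fin l → (Fin n → ℝ) → ℝ) (j : Fin (l + 1)) (hS : S.Nonempty)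
    (hbd : Bornology.IsBounded (bandOver S ξ j)) : j ≠ 0 := by
  obtain ⟨R, hR⟩ := hbd.subset_closedBall 0
  obtain ⟨x, hx⟩ := hS
  rintro rfl
  obtain ⟨c, hc⟩ := KZ.exists_coe_lt_bandUpper ξ 0 x
  have hz : (Fin.snoc x (min c (-R - 1)) : Fin (n + 1) → ℝ) ∈ bandOver S ξ 0 := by
    rw [snoc_mem_bandOver_iff, bandLower_zero]
    exact ⟨hx, EReal.bot_lt_coe _,
      lt_of_le_of_lt (EReal.coe_le_coe_iff.2 (min_le_left _ _)) hc⟩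
  have h1 := (norm_le_and_abs_le_of_snoc_mem hR hz).2
  have h2 : min c (-R - 1) ≤ -R - 1 := min_le_right _ _
  have h3 := (abs_le.1 h1).1
  linarith

/-- **A bounded band over a nonempty base is not the highest band**: the highest band contains,
above any point of the base, a vertical half-line `(c, +∞)`. [cite: BasuPollackRoy2006, Def. 5.1] -/
theorem ne_last_of_isBounded_bandOver {n l : ℕ} {S : Set (Fin n → ℝ)}
    (ξ : Fin l → (Fin n → ℝ) → ℝ) (j : Fin (l + 1)) (hS : S.Nonempty)
    (hbd : Bornology.IsBounded (bandOver S ξ j)) : j ≠ Fin.last l := by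
  obtain ⟨R, hR⟩ := hbd.subset_closedBall 0
  obtain ⟨x, hx⟩ := hS
  rintro rfl
  obtain ⟨c, hc⟩ := KZ.exists_bandLower_lt_coe ξ (Fin.last l) x
  have hz : (Fin.snoc x (max c (R + 1)) : Fin (n + 1) → ℝ) ∈ bandOver S ξ (Fin.last l) := by
    rw [snoc_mem_bandOver_iff, bandUpper_last]
    exact ⟨hx, lt_of_lt_of_le hc (EReal.coe_le_coe_iff.2 (le_max_left _ _)),
      EReal.coe_lt_top _⟩
  have h1 := (norm_le_and_abs_le_of_snoc_mem hR hz).2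
  have h2 : R + 1 ≤ max c (R + 1) := le_max_right _ _
  have h3 := (abs_le.1 h1).2
  linarith

/-- **The base of a bounded band is bounded** when the sections are strictly increasing over the
base: every point `x` of the base then carries a point `(x, t)` of the band, and `‖x‖ ≤ ‖(x, t)‖`.
[cite: BasuPollackRoy2006, Def. 5.1] -/
theorem isBounded_of_isBounded_bandOver {n l : ℕ} {S : Set (Fin n → ℝ)}
    (ξ : Fin l → (Fin n → ℝ) → ℝ) (j : Fin (l + 1)) (hmono : ∀ x ∈ S, StrictMono fun i => ξ i x)
    (hbd : Bornology.IsBounded (bandOver S ξ j)) : Bornology.IsBounded S := by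
  obtain ⟨R, hR⟩ := hbd.subset_closedBall 0
  rw [Metric.isBounded_iff_subset_closedBall 0]
  refine ⟨R, fun y hy => ?_⟩
  obtain ⟨t, ht1, ht2⟩ := CylindricalDecomposition.exists_mem_band ξ y (hmono y hy) j
  rw [Metric.mem_closedBall, dist_zero_right]
  exact (norm_le_and_abs_le_of_snoc_mem hR (snoc_mem_bandOver_iff.2 ⟨hy, ht1, ht2⟩)).1

/-- **Bounded bands are inner bands over bounded bases.** If the `j`-th band over a nonempty base
`S`, cut out by sections strictly increasing over `S`, is bounded, then both of its walls are finite
(`j ≠ 0`, `j ≠ ℓ`) and `S` is bounded. (Without monotonicity an inner band may be empty over an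
unbounded base.) [cite: BasuPollackRoy2006, Def. 5.1] -/
theorem inner_and_isBounded_of_isBounded_bandOver (n l : ℕ) (S : Set (Fin n → ℝ))
    (ξ : Fin l → (Fin n → ℝ) → ℝ) (j : Fin (l + 1)) (hS : S.Nonempty)
    (hmono : ∀ x ∈ S, StrictMono fun i => ξ i x) (hbd : Bornology.IsBounded (bandOver S ξ j)) :
    j ≠ 0 ∧ j ≠ Fin.last l ∧ Bornology.IsBounded S :=
  ⟨ne_zero_of_isBounded_bandOver ξ j hS hbd, ne_last_of_isBounded_bandOver ξ j hS hbd,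
    isBounded_of_isBounded_bandOver ξ j hmono hbd⟩

/-- **A band with continuous finite walls over an open base is open**: for `S ⊆ ℝⁿ` open and
`a, b` continuous on `S`, `{(x, t) | x ∈ S, a x < t < b x}` is open in `ℝⁿ⁺¹` (at a point of the
band, `x ∈ S` is an open condition because `Fin.init` is continuous, and the two strict
inequalities persist nearby by continuity of `a ∘ Fin.init`, `b ∘ Fin.init` at the point).
[cite: BasuPollackRoy2006, Def. 5.1 and Prop. 5.3] -/
theorem isOpen_setOf_init_mem_and_lt_and_lt (n : ℕ) (S : Set (Fin n → ℝ))
    (a b : (Fin n → ℝ) → ℝ) (hS : IsOpen S) (ha : ContinuousOn a S) (hb : ContinuousOn b S) :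
    IsOpen {z : Fin (n + 1) → ℝ | Fin.init z ∈ S ∧ a (Fin.init z) < z (Fin.last n) ∧
      z (Fin.last n) < b (Fin.init z)} := by
  rw [isOpen_iff_mem_nhds]
  rintro z ⟨hzS, hlo, hhi⟩
  have hinit : Continuous fun w : Fin (n + 1) → ℝ => Fin.init w := continuous_id.finInit
  have hSn : S ∈ 𝓝 (Fin.init z) := hS.mem_nhds hzS
  have ha' : ContinuousAt (fun w : Fin (n + 1) → ℝ => a (Fin.init w)) z :=
    ContinuousAt.comp (ha.continuousAt hSn) hinit.continuousAt
  have hb' : ContinuousAt (fun w : Fin (n + 1) → ℝ => b (Fin.init w)) z :=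
    ContinuousAt.comp (hb.continuousAt hSn) hinit.continuousAt
  have hl : ContinuousAt (fun w : Fin (n + 1) → ℝ => w (Fin.last n)) z :=
    (continuous_apply _).continuousAt
  filter_upwards [hinit.continuousAt.preimage_mem_nhds hSn, ha'.eventually_lt hl hlo,
    hl.eventually_lt hb' hhi] with w h1 h2 h3
  exact ⟨h1, h2, h3⟩

/-- **D — cell facts** (corrected form of the registered stub: conjunct (2) carries the hypothesis
that the sections increase strictly over the base, as supplied by `IsCylinderStack`; without it
(2) is false). (1) Every cell of a `ℚ`-cylindrical decomposition of `ℝⁿ` is open or has empty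
interior. (2) A bounded band over a nonempty base with strictly increasing sections is an inner
band (both walls finite) and its base is bounded. (3) A band with continuous finite walls over an
open base is open. [cite: BasuPollackRoy2006, Def. 5.1 and Prop. 5.3] -/
theorem stub_cadCellFacts :
    (∀ (n : ℕ) (𝒮 : Finset (Set (Fin n → ℝ))), IsCylindricalDecomposition ℚ n 𝒮 →
      ∀ S ∈ 𝒮, IsOpen S ∨ interior S = ∅) ∧
    (∀ (n l : ℕ) (S : Set (Fin n → ℝ)) (ξ : Fin l → (Fin n → ℝ) → ℝ) (j : Fin (l + 1)),
      S.Nonempty → (∀ x ∈ S, StrictMono fun i => ξ i x) → Bornology.IsBounded (bandOver S ξ j) →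
      j ≠ 0 ∧ j ≠ Fin.last l ∧ Bornology.IsBounded S) ∧
    (∀ (n : ℕ) (S : Set (Fin n → ℝ)) (a b : (Fin n → ℝ) → ℝ), IsOpen S → ContinuousOn a S →
      ContinuousOn b S → IsOpen {z : Fin (n + 1) → ℝ | Fin.init z ∈ S ∧ a (Fin.init z) < z (Fin.last n) ∧
        z (Fin.last n) < b (Fin.init z)}) :=
  ⟨isOpen_or_interior_eq_empty_of_isCylindricalDecomposition,
    inner_and_isBounded_of_isBounded_bandOver, isOpen_setOf_init_mem_and_lt_and_lt⟩

end Summit.KontsevichZagierPeriods.FurushoPentagon.SectorToKernel
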